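import Mathlib
import Literature.AlgebraicGeometry.Resolution.PlaneNearForms
import Summits.ValiantsHypothesis.ValiantsHypothesis.Theorems.GrenetZeonTwoDimCoefficientsDefs

/-!
# Crux `GrenetZeon.TwoDimCoefficients` (stmt-ValiantsHypothesis-8062) / rung `DualUnipotentThreeHalves` (stmt-24318):
# scaling-closure — SUPPORT GARBAGE in pencil form: `tr(G^k·M)` is linear off the variables of `G`

Plumbing for the mass cut in Hessian currency (✓ `sq_sub_mul_le_of_tracePowParts_add_supportPart`, p838341): if every entry of the
garbage pencil `G` is a polynomial in the variables of a set `S` (`∂_c G_{ab} = 0` for `c ∉ S`) and `M` is AFFINE, then the trace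
contribution `g = tr(G^k·M)` satisfies `∂_c ∂_{c'} g = 0` for all `c, c' ∉ S` — so it is priced `2|S|` by ✓ `rank_hess0_transl_le_of_pderiv_pderiv_eq_zero`.
König garbage `G = ⊕_j x_{rj}·J` / `Σ_j x_{rj} R_j` has `S = row r`, price `2n`.

* `pderiv_pow_apply_eq_zero_of_forall` — entries of `G^k` are again polynomials in `x_S`;
* ★ `pderiv_pderiv_trace_pow_mul_eq_zero` — the statement above.

HONEST FRAMING: unconditional infrastructure; proves no rung: the stub `DualUnipotentBound`, crux 8062, the 24318 decl and
`VP ≠ VNP` remain open.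

References: folklore.
-/

-- single-conjunct layout `Summits/ValiantsHypothesis/ValiantsHypothesis`: the duplicated namespace
-- component is mandated by the tree.
set_option linter.dupNamespace false
set_option autoImplicit false

noncomputable section

namespace Summit.ValiantsHypothesis.ValiantsHypothesis.Theorems.GrenetZeonTwoDimCoefficients.ScalingClosure

open MvPolynomial Matrix
open Summit.ValiantsHypothesis.ValiantsHypothesis.Cruxes.TwoDimCoefficients.DimTwoCases

section SupportGarbage

variable {n s : ℕ}

/-- Entries of powers of a pencil whose entries do not involve the variable `c` do not involve `c`. [folklore] -/
theorem pderiv_pow_apply_eq_zero_of_forall (G : AffMat n s) (c : Fin n × Fin n) (hG : ∀ a b, pderiv c (G a b) = 0) :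
    ∀ (k : ℕ) (a b : Fin s), pderiv c ((G ^ k) a b) = 0 := by
  classical
  intro k
  induction k with
  | zero =>
    intro a b
    rw [pow_zero, Matrix.one_apply]
    split_ifs
    · exact (pderiv c).map_one_eq_zero
    · exact map_zero _
  | succ k ih =>
    intro a b
    rw [pow_succ, Matrix.mul_apply, map_sum]
    refine Finset.sum_eq_zero fun j _ => ?_
    rw [pderiv_mul, ih a j, hG j b, zero_mul, mul_zero, add_zero]

/-- ★ **Support garbage is linear off its variables.**  If every entry of `G` is a polynomial in the variables of `S` and `M` is affine,
then `∂_c ∂_{c'} tr(G^k·M) = 0` for all `c, c' ∉ S`. [folklore] -/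
theorem pderiv_pderiv_trace_pow_mul_eq_zero (G M : AffMat n s) (S : Finset (Fin n × Fin n))
    (hG : ∀ a b, ∀ c ∉ S, pderiv c (G a b) = 0) (hM : IsAffine M) (k : ℕ)
    (c c' : Fin n × Fin n) (hc : c ∉ S) (hc' : c' ∉ S) :
    pderiv c (pderiv c' ((G ^ k * M).trace)) = 0 := by
  classical
  -- second partials of affine entries vanish
  have hM2 : ∀ a b, pderiv c (pderiv c' (M a b)) = 0 := by
    intro a b
    rw [Literature.AlgebraicGeometry.Resolution.eq_C_add_sum_of_totalDegree_le_one (M a b) (hM a b)]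
    simp only [map_add, map_sum, pderiv_C, zero_add, Derivation.leibniz, pderiv_X, smul_eq_mul, mul_zero, add_zero]
    refine Finset.sum_eq_zero fun v _ => ?_
    by_cases hv : v = c'
    · subst hv; simp
    · simp [hv]
  rw [Matrix.trace, map_sum, map_sum]
  refine Finset.sum_eq_zero fun a _ => ?_
  rw [Matrix.diag_apply, Matrix.mul_apply, map_sum, map_sum]
  refine Finset.sum_eq_zero fun b _ => ?_
  rw [pderiv_mul, pderiv_pow_apply_eq_zero_of_forall G c' (fun a' b' => hG a' b' c' hc') k a b, zero_mul, zero_add,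
    pderiv_mul, pderiv_pow_apply_eq_zero_of_forall G c (fun a' b' => hG a' b' c hc) k a b, zero_mul, zero_add, hM2,
    mul_zero]

end SupportGarbage

end Summit.ValiantsHypothesis.ValiantsHypothesis.Theorems.GrenetZeonTwoDimCoefficients.ScalingClosure

end
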